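import Mathlib
import HarnessLib
import Summits.NavierStokesRegularity.NavierStokesRegularity.Theorems.UnthreadedDoorNetFluxNF1aDeltaSlice

/-!
# Route `UnthreadedDoor`, crux `PoloidalLiouville` (stmt-NavierStokesRegularity-1222), WALL W1 `stub_scalarLiouville` —
# crux idea «netflux-typei-gap» (ns-idea-14), NF-1a `stub_extremalHeadEMF`: the (Δ) side — (Δv) THE DANSKIN SLOPE OF THE HEAD DIFFERENCE

KEY-NS #164/#166 division (this seat: conjuncts (ii), (v) of the (Δ) side).  Part (v) of `ExtremalHeadEMF` asks, for a.e. `r > 0`,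
`∂_r I(t,r) ≤ sup_{argmax_{S_r}T(t)} ∂_rP(t,·) − inf_{argmin_{S_r}T(t)} ∂_rP(t,·)`.  Frozen time, `f = T(t)`, `g = P(t)` (`C¹` off `x₀`), the
slice level-Lipschitz property `|g x − g y| ≤ Λ|f x − f y|` on the spheres (hypothesis; = (Λ) of the toolkit) and property (i) of `I`:

* `hasDerivAt_headDiff_of_sliceLevelLip` — **at every radius `r` where `ρ ↦ max_{S_ρ} f` and `ρ ↦ min_{S_ρ} f` are differentiable, `I` IS
  differentiable with `I'(r) = ∂_r g(x⁺) − ∂_r g(x⁻)` for EVERY maximiser `x⁺` and minimiser `x⁻` at `r`.**  Proof: scale `x^±` radially to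
  `S_{r'}`; the radial pieces `g(x̃^±) − g(x^±)` carry the derivative; the end corrections are `≤ Λ·(max_{S_{r'}}f − f(x̃⁺))` (resp. the min
  version), and `r' ↦ max_{S_{r'}}f − f(x₀ + r'u⁺)` vanishes to second order at `r` because the slice touches the envelope from below there
  (Danskin: equal derivatives, `deriv_eq_of_touching_below`) — so they are `o(|r' − r|)`;
* `deriv_headDiff_le_of_sliceLevelLip` — hence `deriv I r ≤ sSup (∂_r g '' argmax) − sInf (∂_r g '' argmin)` at such `r`;
* `ae_differentiableAt_sphSup_of_contDiffOn`, `ae_differentiableAt_sphInf_of_contDiffOn` — `ρ ↦ max/min_{S_ρ} f` are differentiable at a.e.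
  `ρ > 0` (Lipschitz on every `[1/(n+2), n+2]`, Rademacher, countable union);
* **`ae_deriv_headDiff_le_of_sliceLevelLip`** — (Δv) packaged exactly as conjunct (v) of `ExtremalHeadEMF` for the slice:
  `∀ᵐ r, 0 < r → deriv I r ≤ sSup (radDeriv g x₀ '' sphArgmax f x₀ r) − sInf (radDeriv g x₀ '' sphArgmin f x₀ r)`.

WHAT THIS IS NOT: no NS-regularity statement is touched (frozen-time calculus); helper lemmas for one sub-part of NF-1a, which stays OPEN (its
topological/Sard half is ARM A's), as do `PoloidalLiouville` (1222), W1, the rung target and the summit.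
`--supports stmt-NavierStokesRegularity-1222 --as helper`.  [folklore]
-/

noncomputable section

-- the summit and its single sub-problem share the name (CONVENTIONS §1)
set_option linter.dupNamespace false

open Set Function Filter Topology InnerProductSpace MeasureTheory Asymptotics
open scoped RealInnerProductSpace NNReal

namespace Summit.NavierStokesRegularity.NavierStokesRegularity.Theorems.PoloidalLiouville.NetFlux.NF1a

open Literature.Analysis Literature.Analysis.FluidPDE

variable {f g : E3 → ℝ} {x₀ : E3}

/-! ### Danskin at a differentiability radius: the derivative of the head difference -/

/-- **The head difference is differentiable at every Danskin radius, with derivative `∂_r g(x⁺) − ∂_r g(x⁻)` for EVERY extremiser pair.**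
Data: `f, g ∈ C¹(ℝ³ ∖ {x₀})`; the slice level-Lipschitz property with constant `Λ` on the spheres of radii in `[a,b]` (`0 < a`); property (i)
of `I` there; `r ∈ ]a,b[` at which `ρ ↦ max_{S_ρ} f` and `ρ ↦ min_{S_ρ} f` are differentiable. [folklore] -/
theorem hasDerivAt_headDiff_of_sliceLevelLip (hf : ContDiffOn ℝ 1 f ({x₀}ᶜ : Set E3)) (hg : ContDiffOn ℝ 1 g ({x₀}ᶜ : Set E3))
    {a b Λ : ℝ} (ha : 0 < a)
    (hΛ : ∀ ρ ∈ Icc a b, ∀ x ∈ Metric.sphere x₀ ρ, ∀ y ∈ Metric.sphere x₀ ρ, |g x - g y| ≤ Λ * |f x - f y|)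
    {I : ℝ → ℝ} (hI : ∀ ρ ∈ Icc a b, ∀ xp ∈ sphArgmax f x₀ ρ, ∀ xm ∈ sphArgmin f x₀ ρ, I ρ = g xp - g xm)
    {r : ℝ} (hr : r ∈ Ioo a b)
    (hdS : DifferentiableAt ℝ (fun ρ => sphSup f x₀ ρ) r) (hdI : DifferentiableAt ℝ (fun ρ => sphInf f x₀ ρ) r)
    {xp xm : E3} (hxp : xp ∈ sphArgmax f x₀ r) (hxm : xm ∈ sphArgmin f x₀ r) :
    HasDerivAt I (radDeriv g x₀ xp - radDeriv g x₀ xm) r := by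
  have hO : IsOpen ({x₀}ᶜ : Set E3) := isOpen_compl_singleton
  have hr0 : 0 < r := ha.trans hr.1
  have hrI : r ∈ Icc a b := Ioo_subset_Icc_self hr
  have hfc : ContinuousOn f ({x₀}ᶜ) := hf.continuousOn
  have hS : ∀ ρ : ℝ, 0 < ρ → ContinuousOn f (Metric.sphere x₀ ρ) := fun ρ hρ =>
    continuousOn_sphere_of_continuousOn_compl hfc hρ
  have hfd : ∀ y : E3, y ≠ x₀ → DifferentiableAt ℝ f y := fun y hy =>
    (hf.differentiableOn one_ne_zero y hy).differentiableAt (hO.mem_nhds hy)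
  have hgd : ∀ y : E3, y ≠ x₀ → DifferentiableAt ℝ g y := fun y hy =>
    (hg.differentiableOn one_ne_zero y hy).differentiableAt (hO.mem_nhds hy)
  -- unit radial vectors and the rays through the extremisers
  obtain ⟨hup, hxpu, -⟩ := radialScale_mem_sphere (x₀ := x₀) hr0 hr0.le hxp.1
  obtain ⟨hum, hxmu, -⟩ := radialScale_mem_sphere (x₀ := x₀) hr0 hr0.le hxm.1
  set up : E3 := r⁻¹ • (xp - x₀) with hup_def
  set um : E3 := r⁻¹ • (xm - x₀) with hum_def
  have hxpne : xp ≠ x₀ := ne_center_of_mem_sphere hr0 hxp.1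
  have hxmne : xm ≠ x₀ := ne_center_of_mem_sphere hr0 hxm.1
  have hxpn : ‖xp - x₀‖ = r := mem_sphere_iff_norm.1 hxp.1
  have hxmn : ‖xm - x₀‖ = r := mem_sphere_iff_norm.1 hxm.1
  have hray : ∀ {u : E3}, ‖u‖ = 1 → ∀ ρ : ℝ, 0 < ρ → x₀ + ρ • u ∈ Metric.sphere x₀ ρ := fun hu ρ hρ => by
    rw [mem_sphere_iff_norm, add_sub_cancel_left, norm_smul, hu, mul_one, Real.norm_of_nonneg hρ.le]
  -- derivatives of the rays of `g` at `r`: the radial derivatives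
  have hgp : HasDerivAt (fun ρ : ℝ => g (x₀ + ρ • up)) (radDeriv g x₀ xp) r := by
    have h := hasDerivAt_radial (x₀ := x₀) (ξ := up) (ρ := r) (by rw [← hxpu]; exact hgd xp hxpne)
    rw [← hxpu] at h
    have e : radDeriv g x₀ xp = fderiv ℝ g xp up := by rw [radDeriv_eq_fderiv hxpne (hgd xp hxpne), hxpn]
    rw [e]; exact h
  have hgm : HasDerivAt (fun ρ : ℝ => g (x₀ + ρ • um)) (radDeriv g x₀ xm) r := by
    have h := hasDerivAt_radial (x₀ := x₀) (ξ := um) (ρ := r) (by rw [← hxmu]; exact hgd xm hxmne)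
    rw [← hxmu] at h
    have e : radDeriv g x₀ xm = fderiv ℝ g xm um := by rw [radDeriv_eq_fderiv hxmne (hgd xm hxmne), hxmn]
    rw [e]; exact h
  -- the rays of `f` touch the envelopes at `r`: Danskin
  have hfp : DifferentiableAt ℝ (fun ρ : ℝ => f (x₀ + ρ • up)) r :=
    (hasDerivAt_radial (x₀ := x₀) (ξ := up) (ρ := r) (by rw [← hxpu]; exact hfd xp hxpne)).differentiableAt
  have hfm : DifferentiableAt ℝ (fun ρ : ℝ => f (x₀ + ρ • um)) r :=
    (hasDerivAt_radial (x₀ := x₀) (ξ := um) (ρ := r) (by rw [← hxmu]; exact hfd xm hxmne)).differentiableAt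
  have hnhds : ∀ᶠ ρ in 𝓝 r, 0 < ρ := lt_mem_nhds hr0
  have hleS : ∀ᶠ ρ in 𝓝 r, f (x₀ + ρ • up) ≤ sphSup f x₀ ρ := by
    filter_upwards [hnhds] with ρ hρ using le_sphSup (hS ρ hρ) (hray hup ρ hρ)
  have heqS : f (x₀ + r • up) = sphSup f x₀ r := by rw [← hxpu]; exact (sphSup_eq_of_mem_sphArgmax (hS r hr0) hxp).symm
  have hDS : deriv (fun ρ => sphSup f x₀ ρ) r = deriv (fun ρ : ℝ => f (x₀ + ρ • up)) r :=
    deriv_eq_of_touching_below hleS heqS hdS hfp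
  have hleI : ∀ᶠ ρ in 𝓝 r, sphInf f x₀ ρ ≤ f (x₀ + ρ • um) := by
    filter_upwards [hnhds] with ρ hρ using sphInf_le (hS ρ hρ) (hray hum ρ hρ)
  have heqI : sphInf f x₀ r = f (x₀ + r • um) := by rw [← hxmu]; exact sphInf_eq_of_mem_sphArgmin (hS r hr0) hxm
  have hDI : deriv (fun ρ : ℝ => f (x₀ + ρ • um)) r = deriv (fun ρ => sphInf f x₀ ρ) r :=
    deriv_eq_of_touching_below hleI heqI hfm hdI
  -- the defects `D⁺ = max − slice ≥ 0`, `D⁻ = slice − min ≥ 0` vanish to second order at `r`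
  have hDp : (fun ρ => sphSup f x₀ ρ - f (x₀ + ρ • up)) =o[𝓝 r] fun ρ => ρ - r := by
    have h1 : HasDerivAt (fun ρ => sphSup f x₀ ρ - f (x₀ + ρ • up)) 0 r := by
      have h := hdS.hasDerivAt.sub hfp.hasDerivAt
      rw [hDS, sub_self] at h
      exact h
    have h2 := (hasDerivAt_iff_isLittleO.1 h1)
    simpa only [heqS, sub_self, smul_zero, sub_zero] using h2
  have hDm : (fun ρ => f (x₀ + ρ • um) - sphInf f x₀ ρ) =o[𝓝 r] fun ρ => ρ - r := by
    have h1 : HasDerivAt (fun ρ => f (x₀ + ρ • um) - sphInf f x₀ ρ) 0 r := by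
      have h := hfm.hasDerivAt.sub hdI.hasDerivAt
      rw [hDI, sub_self] at h
      exact h
    have h2 := (hasDerivAt_iff_isLittleO.1 h1)
    simpa only [heqI, sub_self, smul_zero, sub_zero] using h2
  -- extremisers at every radius (choice)
  have hexp : ∀ ρ : ℝ, ∃ x : E3, 0 < ρ → x ∈ sphArgmax f x₀ ρ := fun ρ => by
    by_cases hρ : 0 < ρ
    · obtain ⟨x, hx⟩ := exists_mem_sphArgmax (hS ρ hρ) hρ.le
      exact ⟨x, fun _ => hx⟩
    · exact ⟨x₀, fun h => absurd h hρ⟩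
  have hexm : ∀ ρ : ℝ, ∃ x : E3, 0 < ρ → x ∈ sphArgmin f x₀ ρ := fun ρ => by
    by_cases hρ : 0 < ρ
    · obtain ⟨x, hx⟩ := exists_mem_sphArgmin' (hS ρ hρ) hρ.le
      exact ⟨x, fun _ => hx⟩
    · exact ⟨x₀, fun h => absurd h hρ⟩
  choose Xp hXp using hexp
  choose Xm hXm using hexm
  -- the end corrections are `O(defect)`, hence `o(ρ − r)`
  have hIcc : ∀ᶠ ρ in 𝓝 r, ρ ∈ Icc a b := Icc_mem_nhds hr.1 hr.2
  have hEp : (fun ρ => g (Xp ρ) - g (x₀ + ρ • up)) =o[𝓝 r] fun ρ => ρ - r := by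
    refine IsBigO.trans_isLittleO (IsBigO.of_bound Λ ?_) hDp
    filter_upwards [hIcc, hnhds] with ρ hρ hρ0
    have h := hΛ ρ hρ (Xp ρ) (hXp ρ hρ0).1 (x₀ + ρ • up) (hray hup ρ hρ0)
    have hle : f (x₀ + ρ • up) ≤ f (Xp ρ) := (hXp ρ hρ0).2 _ (hray hup ρ hρ0)
    have hsup : sphSup f x₀ ρ = f (Xp ρ) := sphSup_eq_of_mem_sphArgmax (hS ρ hρ0) (hXp ρ hρ0)
    rw [Real.norm_eq_abs, Real.norm_eq_abs, hsup, abs_of_nonneg (sub_nonneg.2 hle)]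
    rwa [abs_of_nonneg (sub_nonneg.2 hle)] at h
  have hEm : (fun ρ => g (Xm ρ) - g (x₀ + ρ • um)) =o[𝓝 r] fun ρ => ρ - r := by
    refine IsBigO.trans_isLittleO (IsBigO.of_bound Λ ?_) hDm
    filter_upwards [hIcc, hnhds] with ρ hρ hρ0
    have h := hΛ ρ hρ (Xm ρ) (hXm ρ hρ0).1 (x₀ + ρ • um) (hray hum ρ hρ0)
    have hle : f (Xm ρ) ≤ f (x₀ + ρ • um) := (hXm ρ hρ0).2 _ (hray hum ρ hρ0)
    have hinf : sphInf f x₀ ρ = f (Xm ρ) := sphInf_eq_of_mem_sphArgmin (hS ρ hρ0) (hXm ρ hρ0)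
    rw [Real.norm_eq_abs, Real.norm_eq_abs, hinf, abs_of_nonneg (sub_nonneg.2 hle)]
    rwa [abs_of_nonpos (sub_nonpos.2 hle), neg_sub] at h
  -- the radial pieces carry the derivative
  have hRp := hasDerivAt_iff_isLittleO.1 hgp
  have hRm := hasDerivAt_iff_isLittleO.1 hgm
  -- assemble
  rw [hasDerivAt_iff_isLittleO]
  have hsum := ((hEp.add hRp).sub (hEm.add hRm))
  refine hsum.congr' ?_ (Eventually.of_forall fun _ => rfl)
  filter_upwards [hIcc, hnhds] with ρ hρ hρ0
  have hIρ : I ρ = g (Xp ρ) - g (Xm ρ) := hI ρ hρ (Xp ρ) (hXp ρ hρ0) (Xm ρ) (hXm ρ hρ0)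
  have hIr : I r = g xp - g xm := hI r hrI xp hxp xm hxm
  rw [hIρ, hIr, smul_eq_mul, smul_eq_mul, smul_eq_mul]
  have e1 : g (x₀ + r • up) = g xp := by rw [← hxpu]
  have e2 : g (x₀ + r • um) = g xm := by rw [← hxmu]
  rw [e1, e2]
  ring

/-- **(Δv) at a Danskin radius**: `deriv I r ≤ sSup (∂_r g '' argmax_{S_r} f) − sInf (∂_r g '' argmin_{S_r} f)` (the derivative is
`∂_r g(x⁺) − ∂_r g(x⁻)` for some — indeed every — extremiser pair, and `∂_r g` is continuous on the compact argmax/argmin). [folklore] -/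
theorem deriv_headDiff_le_of_sliceLevelLip (hf : ContDiffOn ℝ 1 f ({x₀}ᶜ : Set E3)) (hg : ContDiffOn ℝ 1 g ({x₀}ᶜ : Set E3))
    {a b Λ : ℝ} (ha : 0 < a)
    (hΛ : ∀ ρ ∈ Icc a b, ∀ x ∈ Metric.sphere x₀ ρ, ∀ y ∈ Metric.sphere x₀ ρ, |g x - g y| ≤ Λ * |f x - f y|)
    {I : ℝ → ℝ} (hI : ∀ ρ ∈ Icc a b, ∀ xp ∈ sphArgmax f x₀ ρ, ∀ xm ∈ sphArgmin f x₀ ρ, I ρ = g xp - g xm)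
    {r : ℝ} (hr : r ∈ Ioo a b)
    (hdS : DifferentiableAt ℝ (fun ρ => sphSup f x₀ ρ) r) (hdI : DifferentiableAt ℝ (fun ρ => sphInf f x₀ ρ) r) :
    deriv I r ≤ sSup (radDeriv g x₀ '' sphArgmax f x₀ r) - sInf (radDeriv g x₀ '' sphArgmin f x₀ r) := by
  have hr0 : 0 < r := ha.trans hr.1
  have hfc : ContinuousOn f ({x₀}ᶜ) := hf.continuousOn
  have hgc : ContinuousOn (radDeriv g x₀) ({x₀}ᶜ) := continuousOn_radDeriv_of_contDiffOn hg
  have hfS : ContinuousOn f (Metric.sphere x₀ r) := continuousOn_sphere_of_continuousOn_compl hfc hr0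
  obtain ⟨xp, hxp⟩ := exists_mem_sphArgmax hfS hr0.le
  obtain ⟨xm, hxm⟩ := exists_mem_sphArgmin' hfS hr0.le
  have hD := hasDerivAt_headDiff_of_sliceLevelLip hf hg ha hΛ hI hr hdS hdI hxp hxm
  rw [hD.deriv]
  obtain ⟨-, hbA⟩ := exists_mem_sphArgmax_sSup_eq hr0 hfc hgc
  obtain ⟨-, hbB⟩ := exists_mem_sphArgmin_sInf_eq hr0 hfc hgc
  have h1 : radDeriv g x₀ xp ≤ sSup (radDeriv g x₀ '' sphArgmax f x₀ r) := le_csSup hbA ⟨xp, hxp, rfl⟩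
  have h2 : sInf (radDeriv g x₀ '' sphArgmin f x₀ r) ≤ radDeriv g x₀ xm := csInf_le hbB ⟨xm, hxm, rfl⟩
  linarith

/-! ### The envelopes are differentiable at a.e. radius -/

/-- **`ρ ↦ max_{S_ρ(x₀)} f` is differentiable at a.e. `ρ > 0`** for `f ∈ C¹(ℝ³ ∖ {x₀})`: it is Lipschitz on every `[1/(n+2), n+2]`
(`exists_lipschitz_sphSup_sphInf`, ARM A's `…ExtremalHeadCore`), hence differentiable a.e. there (Rademacher on `ℝ`), and `]0,∞[` is the countable union of the interiors.
[folklore] -/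
theorem ae_differentiableAt_sphSup_of_contDiffOn (hf : ContDiffOn ℝ 1 f ({x₀}ᶜ : Set E3)) :
    ∀ᵐ ρ : ℝ, 0 < ρ → DifferentiableAt ℝ (fun ρ => sphSup f x₀ ρ) ρ := by
  have hn : ∀ n : ℕ, ∀ᵐ ρ : ℝ, ρ ∈ Ioo (1 / ((n : ℝ) + 2)) ((n : ℝ) + 2) →
      DifferentiableAt ℝ (fun ρ => sphSup f x₀ ρ) ρ := by
    intro n
    have ha : (0 : ℝ) < 1 / ((n : ℝ) + 2) := by positivity
    obtain ⟨G, hG0, hG⟩ := exists_lipschitz_sphSup_sphInf hf ha (b := (n : ℝ) + 2)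
    have hL : LipschitzOnWith (Real.toNNReal G) (fun ρ => sphSup f x₀ ρ) (Icc (1 / ((n : ℝ) + 2)) ((n : ℝ) + 2)) := by
      refine LipschitzOnWith.of_dist_le_mul fun ρ' hρ' ρ hρ => ?_
      rw [Real.coe_toNNReal _ hG0, Real.dist_eq, Real.dist_eq]
      exact (hG ρ' hρ' ρ hρ).1
    filter_upwards [hL.ae_differentiableWithinAt_of_mem (μ := volume)] with ρ hρ hρI
    exact (hρ (Ioo_subset_Icc_self hρI)).differentiableAt (Icc_mem_nhds hρI.1 hρI.2)
  rw [← ae_all_iff] at hn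
  filter_upwards [hn] with ρ hρ hρ0
  -- pick `n` with `ρ ∈ ]1/(n+2), n+2[`
  obtain ⟨n, hn1⟩ := exists_nat_gt (max ρ (1 / ρ))
  have hnρ : ρ < (n : ℝ) + 2 := by linarith [le_max_left ρ (1 / ρ)]
  have hn2 : 1 / ρ < (n : ℝ) + 2 := by linarith [le_max_right ρ (1 / ρ)]
  have hlow : 1 / ((n : ℝ) + 2) < ρ := by
    rw [div_lt_iff₀ (by positivity)]
    rw [div_lt_iff₀ hρ0] at hn2
    linarith
  exact hρ n ⟨hlow, hnρ⟩

/-- **`ρ ↦ min_{S_ρ(x₀)} f` is differentiable at a.e. `ρ > 0`** for `f ∈ C¹(ℝ³ ∖ {x₀})` (the `sup` statement for `−f`). [folklore] -/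
theorem ae_differentiableAt_sphInf_of_contDiffOn (hf : ContDiffOn ℝ 1 f ({x₀}ᶜ : Set E3)) :
    ∀ᵐ ρ : ℝ, 0 < ρ → DifferentiableAt ℝ (fun ρ => sphInf f x₀ ρ) ρ := by
  filter_upwards [ae_differentiableAt_sphSup_of_contDiffOn (x₀ := x₀) hf.neg] with ρ hρ hρ0
  have e : (fun ρ => sphInf f x₀ ρ) = fun ρ => -sphSup (fun y => -f y) x₀ ρ :=
    funext fun ρ => sphInf_eq_neg_sphSup_neg f x₀ ρ
  rw [e]
  exact (hρ hρ0).neg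

/-! ### (Δv) packaged as conjunct (v) of `ExtremalHeadEMF` for the slice -/

/-- **(Δv), packaged for the window slice**: with `f = T(t)`, `g = P(t)` in `C¹(ℝ³ ∖ {x₀})`, the slice level-Lipschitz property at every radius
`r > 0` with constant `V·r` (`V ≥ 0`) and property (i) of `I` at every `r > 0`:
`∀ᵐ r, 0 < r → deriv I r ≤ sSup (radDeriv g x₀ '' sphArgmax f x₀ r) − sInf (radDeriv g x₀ '' sphArgmin f x₀ r)`. [folklore] -/
theorem ae_deriv_headDiff_le_of_sliceLevelLip (hf : ContDiffOn ℝ 1 f ({x₀}ᶜ : Set E3)) (hg : ContDiffOn ℝ 1 g ({x₀}ᶜ : Set E3))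
    {V : ℝ} (hV : 0 ≤ V)
    (hΛ : ∀ r > 0, ∀ x ∈ Metric.sphere x₀ r, ∀ y ∈ Metric.sphere x₀ r, |g x - g y| ≤ V * r * |f x - f y|)
    {I : ℝ → ℝ} (hI : ∀ r > 0, ∀ xp ∈ sphArgmax f x₀ r, ∀ xm ∈ sphArgmin f x₀ r, I r = g xp - g xm) :
    ∀ᵐ r : ℝ, 0 < r →
      deriv I r ≤ sSup (radDeriv g x₀ '' sphArgmax f x₀ r) - sInf (radDeriv g x₀ '' sphArgmin f x₀ r) := by
  filter_upwards [ae_differentiableAt_sphSup_of_contDiffOn (x₀ := x₀) hf,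
    ae_differentiableAt_sphInf_of_contDiffOn (x₀ := x₀) hf] with r hS hI' hr0
  -- work on `[r/2, 2r]` with the uniform constant `V · 2r`
  have ha : 0 < r / 2 := by positivity
  have hrI : r ∈ Ioo (r / 2) (2 * r) := ⟨by linarith, by linarith⟩
  refine deriv_headDiff_le_of_sliceLevelLip hf hg ha (Λ := V * (2 * r)) ?_ ?_ hrI (hS hr0) (hI' hr0)
  · intro ρ hρ x hx y hy
    have hρ0 : 0 < ρ := ha.trans_le hρ.1
    calc |g x - g y| ≤ V * ρ * |f x - f y| := hΛ ρ hρ0 x hx y hy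
      _ ≤ V * (2 * r) * |f x - f y| :=
          mul_le_mul_of_nonneg_right (mul_le_mul_of_nonneg_left hρ.2 hV) (abs_nonneg _)
  · exact fun ρ hρ => hI ρ (ha.trans_le hρ.1)

end Summit.NavierStokesRegularity.NavierStokesRegularity.Theorems.PoloidalLiouville.NetFlux.NF1a

end
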